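import Summits.HodgeConjecture.HodgeConjecture.Theorems.F0P3cStCharTSPs2Kind3          -- ★ p851400 «PS2-KIND3★»: generic `smoothTrace_eq_add_of_constituents_eq_pair` (trace additivity over a labelled pair)
import Summits.HodgeConjecture.HodgeConjecture.Theorems.F0P3cStCharTSStChar             -- ★ p851315 (this seat) «ST-CHAR★»: the case-(1) pair `χ_St(ψ)`, `continuous_stFst`
import HarnessLib

/-!
# F0 · P3c · line LH6 «StCharTS» — «PS2-KIND2★»: the kind-2 clause of (PS2) AT THE MODEL — «`Tr ψ∘det_G + Tr St_G(ψ) = Tr i_G(χ_St(ψ))`» for the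
# labelled pair of the case-(1) principal series of `U(Φ₃)(L⁺_v)` [Rogawski1990, §12.2 (1); §12.6 Prop. 12.6.1 (b)] (datum road, (PS2) kind 2, model core)

Cell `pub/hodgecm-mathlib`, crux H413 = `stmt-HodgeConjecture-24833` (lane `--supports … --as helper`), route HCCMUnconditional; seat F0P2-p06 (g17).
THEOREMS ONLY; ★-only imports.

WHAT.  For every continuous `ψ : E¹_v →* ℂˣ` and every labelled pair `(π₁, πSt)` of the case-(1) principal series `i_G(χ_St(ψ))`,
`χ_St(ψ) = ((‖·‖^{1/2}‖·‖^{1/2})⁻¹, ψ)` (★ «ST-CHAR★»; the pair is produced by ★ «ST-LABELS★» (B4) ∕ pinned by ★ «ST-PIN★» as `(detG ψ', stG ψ')`):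
`Tr π₁(f) + Tr πSt(f) = Tr i_G(χ_St(ψ))(f)` for every `f` — the length-two trace additivity ★ `smoothTrace_eq_add_of_constituents_eq_pair` (multiplicity one, no
`3`-chain by ★ N3 `u3PrincipalSeriesLengthLeTwo_holds`, admissibility ★ `isAdmissible_cmPrincipalSeries`).  This is the MODEL core of the kind-2 clause of the
(S-𝔇) conjunct (PS2) «`¬ IsL2 π → IsL2 σ → IsEllipticPair π σ → Tr π + Tr σ = Tr i_G(par π)`» for the pair `{St_G(ψ), ψ∘det_G}`; the datum glue at `par (𝔇.detG ψ')`
(W-normalisation ∕ cuspidal support) is LH6-p02 (g5)'s «PS2-KIND2-DATUM», feeding `hK2` of ★ `F0P3cStCharTSPs2Assembly.ps2_of_kinds`.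
HONEST LABEL: HC_CM is proved only modulo the 7 printed citations (2 remaining named inputs: hLiu418 = `stmt-HodgeConjecture-24832`, h413 =
`stmt-HodgeConjecture-24833`) until rung 0 closes; count-neutral.

## References
* [Rogawski1990] J. D. Rogawski, *Automorphic Representations of Unitary Groups in Three Variables*, Ann. of Math. Stud. 123 (1990): §12.2 (1) p. 173; §12.6
  Prop. 12.6.1 (b) p. 188 («`χ_π + χ_{π′}` is the character of a principal series»).
* [Casselman1995] W. Casselman, *Introduction to the theory of admissible representations of `p`-adic reductive groups* (1995), Cor. 7.1.2.
-/

set_option autoImplicit false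
-- the mandated namespace has the single-problem summit's repeated segment (`HodgeConjecture.HodgeConjecture`)
set_option linter.dupNamespace false

noncomputable section

open NumberField IsDedekindDomain MeasureTheory Topology
open scoped Matrix MatrixGroups NNReal
open Literature.NumberTheory.Rogawski1990 Literature.NumberTheory.Automorphic Literature.NumberTheory.Automorphic.UnitaryGroup

namespace Summit.HodgeConjecture.HodgeConjecture.Cruxes.H413.F0P3cStCharTSPs2Kind2

variable (L : Type) [Field L] [NumberField L] [IsCMField L] (v : HeightOneSpectrum (𝓞 ↥(maximalRealSubfield L)))

set_option synthInstance.maxHeartbeats 400000 in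
set_option maxHeartbeats 8000000 in  -- the `Gqs L v` ∕ literal-carrier bookkeeping of `cmPrincipalSeries` + ★ N3's `Subrepresentation` frame (cf. ★ Ps2Kind3 §2)
/-- **(PS2) KIND 2 AT THE MODEL: `Tr π₁(f) + Tr πSt(f) = Tr i_G(χ_St(ψ))(f)`** for the labelled pair `(π₁, πSt)` («`{ψ∘det_G, St_G(ψ)} = JH(i_G(χ))`») of the case-(1)
principal series at a non-split place — ★ `smoothTrace_eq_add_of_constituents_eq_pair` with ★ N3 (no `3`-chain in `i_G(χ_St(ψ))`) and ★ admissibility; the pair is any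
`(π₁, πSt)` with the constituent list `c = πSt ∨ c = π₁` (★ B4 `stLabels` ∕ ★ E `exists_stDetFields`: `π₁ := detG ψ'`, `πSt := stG ψ'`).
[cite: Rogawski1990, §12.6 Prop. 12.6.1 (b) p. 188; §12.2 (1) p. 173] [cite: Casselman1995, Cor. 7.1.2] -/
theorem ps2_kind2_stChar (hns : ∀ w : PlacesOver L v, IsCMField.complexConj L • w.1 = w.1)
    [MeasurableSpace (Gqs L v)] [BorelSpace (Gqs L v)] (νQv : Measure (Gqs L v)) [IsFiniteMeasureOnCompacts νQv]
    (ψ : ↥(normOneUnits (conjLocal L (IsCMField.complexConj L) v)) →* ℂˣ) (hψ : Continuous ψ)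
    {π₁ πSt : IrrClass (Gqs L v)} (hne : π₁ ≠ πSt)
    (hall : ∀ c : IrrClass (Gqs L v),
      c.IsConstituentOf (cmPrincipalSeries L 3 v (cmTorusCharPair L v (halfModulusChar (LocalRing L v) * halfModulusChar (LocalRing L v))⁻¹ ψ)) ↔
        (c = πSt ∨ c = π₁))
    (f : Gqs L v → ℂ) :
    π₁.smoothTrace νQv f + πSt.smoothTrace νQv f =
      Representation.smoothTrace (G := Gqs L v)
        (cmPrincipalSeries L 3 v (cmTorusCharPair L v (halfModulusChar (LocalRing L v) * halfModulusChar (LocalRing L v))⁻¹ ψ)) νQv f := by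
  have hadm := F0P3XiUnramNonsplitInstance.isAdmissible_cmPrincipalSeries L v
    (cmTorusCharPair L v (halfModulusChar (LocalRing L v) * halfModulusChar (LocalRing L v))⁻¹ ψ)
  have hlen := F0P3U3PrincipalSeriesLettersHold.u3PrincipalSeriesLengthLeTwo_holds L v hns
    (halfModulusChar (LocalRing L v) * halfModulusChar (LocalRing L v))⁻¹ ψ (F0P3cStCharTSStChar.continuous_stFst L v) (Units.continuous_val.comp hψ)
  have h := F0P3cStCharTSPs2Kind3.smoothTrace_eq_add_of_constituents_eq_pair π₁ πSt hne νQv f hadm hlen hall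
  rw [add_comm] at h
  exact h

/-- The same with the summands in the labelled order `Tr πSt + Tr π₁`. [cite: Rogawski1990, §12.6 Prop. 12.6.1 (b) p. 188] -/
theorem ps2_kind2_stChar' (hns : ∀ w : PlacesOver L v, IsCMField.complexConj L • w.1 = w.1)
    [MeasurableSpace (Gqs L v)] [BorelSpace (Gqs L v)] (νQv : Measure (Gqs L v)) [IsFiniteMeasureOnCompacts νQv]
    (ψ : ↥(normOneUnits (conjLocal L (IsCMField.complexConj L) v)) →* ℂˣ) (hψ : Continuous ψ)
    {π₁ πSt : IrrClass (Gqs L v)} (hne : π₁ ≠ πSt)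
    (hall : ∀ c : IrrClass (Gqs L v),
      c.IsConstituentOf (cmPrincipalSeries L 3 v (cmTorusCharPair L v (halfModulusChar (LocalRing L v) * halfModulusChar (LocalRing L v))⁻¹ ψ)) ↔
        (c = πSt ∨ c = π₁))
    (f : Gqs L v → ℂ) :
    πSt.smoothTrace νQv f + π₁.smoothTrace νQv f =
      Representation.smoothTrace (G := Gqs L v)
        (cmPrincipalSeries L 3 v (cmTorusCharPair L v (halfModulusChar (LocalRing L v) * halfModulusChar (LocalRing L v))⁻¹ ψ)) νQv f := by
  rw [add_comm]
  exact ps2_kind2_stChar L v hns νQv ψ hψ hne hall f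

end Summit.HodgeConjecture.HodgeConjecture.Cruxes.H413.F0P3cStCharTSPs2Kind2

end
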